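import Mathlib

/-!
# No functional of nilpotent type in compact type (input of `LieExponent.md`, §3.19, Theorem 7)

Solo-blind seat (MatrixMultiplication).  Theorems 6 and 7 of the companion note reduce a TPP
triple of submanifolds in the "hyperplane format" to a functional `μ ≠ 0` on the Lie algebra `𝔤`
that vanishes on its own coadjoint stabiliser `𝔤^μ = {Y | μ ∘ ad Y = 0}` ("nilpotent type").
Theorem 7 (every connected real reductive Lie group of rank ≤ 5 and every compact connected Lie
group of rank ≤ 6 has Lie exponent ≥ 3, in the sense of Blasiak–Cohn–Grochow–Pratt–Umans,
arXiv:2204.03826, Def. 4.1) uses, for compact groups, that COMPACT TYPE HAS NO SUCH FUNCTIONAL: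
with an invariant inner product `B`, every `μ` is `B(X, ·)`, `X ∈ 𝔤^μ` and `μ(X) = B(X, X) > 0`.
This file proves exactly that, for an arbitrary real Lie algebra carrying a positive definite
invariant bilinear form:

* `soloLie_inner_self_lie_eq_zero` — `B X ⁅X, Z⁆ = 0` (so `X ∈ 𝔤^{B(X,·)}`);
* `soloLie_separatingLeft_of_pos`, `soloLie_nondegenerate_of_pos` — positivity gives nondegeneracy;
* `soloLie_not_nilpotent_type_of_invariant_inner_product` — for every `μ ≠ 0` there is
  `Y ∈ 𝔤^μ` with `μ Y ≠ 0`;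
* `soloLie_eq_zero_of_vanishing_on_stabilizer` — contrapositive form used in the note: a functional
  vanishing on its coadjoint stabiliser is zero.
-/

set_option linter.dupNamespace false

namespace Summit.MatrixMultiplication.MatrixMultiplication.Theorems

open LinearMap (BilinForm)

variable {L : Type*} [LieRing L] [LieAlgebra ℝ L]

/-- For an invariant bilinear form (`B ⁅x,y⁆ z = B x ⁅y,z⁆`), `B X ⁅X, Z⁆ = B ⁅X,X⁆ Z = 0`:
the vector `X` lies in the coadjoint stabiliser of the functional `B X`. -/
theorem soloLie_inner_self_lie_eq_zero (B : BilinForm ℝ L)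
    (hB : ∀ x y z : L, B ⁅x, y⁆ z = B x ⁅y, z⁆) (X Z : L) : B X ⁅X, Z⁆ = 0 := by
  rw [← hB, lie_self, map_zero, LinearMap.zero_apply]

/-- A positive definite bilinear form is left-separating. -/
theorem soloLie_separatingLeft_of_pos (B : BilinForm ℝ L) (hpos : ∀ x : L, x ≠ 0 → 0 < B x x) :
    B.SeparatingLeft := by
  intro x hx
  by_contra h
  exact (lt_irrefl (0 : ℝ)) (by simpa [hx x] using hpos x h)

/-- A positive definite bilinear form is nondegenerate. -/
theorem soloLie_nondegenerate_of_pos (B : BilinForm ℝ L) (hpos : ∀ x : L, x ≠ 0 → 0 < B x x) :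
    B.Nondegenerate := by
  refine ⟨soloLie_separatingLeft_of_pos B hpos, ?_⟩
  intro y hy
  by_contra h
  exact (lt_irrefl (0 : ℝ)) (by simpa [hy y] using hpos y h)

/-- **Compact type has no functional of nilpotent type.**  If the real Lie algebra `L` carries a
positive definite invariant bilinear form, then every nonzero functional `μ` takes a nonzero value
on some element of its coadjoint stabiliser `{Y | ∀ Z, μ ⁅Y, Z⁆ = 0}` — namely on `X = B⁻¹ μ`,
where `μ X = B X X > 0` (LieExponent.md §3.19, proof of Theorem 7; Cor. 6.3). -/
theorem soloLie_not_nilpotent_type_of_invariant_inner_product [FiniteDimensional ℝ L]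
    (B : BilinForm ℝ L) (hB : ∀ x y z : L, B ⁅x, y⁆ z = B x ⁅y, z⁆)
    (hpos : ∀ x : L, x ≠ 0 → 0 < B x x) (μ : Module.Dual ℝ L) (hμ : μ ≠ 0) :
    ∃ Y : L, (∀ Z : L, μ ⁅Y, Z⁆ = 0) ∧ μ Y ≠ 0 := by
  have hnd : B.Nondegenerate := soloLie_nondegenerate_of_pos B hpos
  set X : L := (B.toDual hnd).symm μ with hXdef
  have hBX : ∀ v : L, B X v = μ v := fun v =>
    LinearMap.BilinForm.apply_toDual_symm_apply (hB := hnd) μ v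
  have hX0 : X ≠ 0 := by
    intro h0
    apply hμ
    ext v
    rw [← hBX v, h0, map_zero, LinearMap.zero_apply]
  refine ⟨X, fun Z => ?_, ?_⟩
  · rw [← hBX]
    exact soloLie_inner_self_lie_eq_zero B hB X Z
  · rw [← hBX]
    exact (hpos X hX0).ne'

/-- Contrapositive used in the note: in compact type, a functional vanishing on its own coadjoint
stabiliser is zero.  Hence the pinned functional produced by Theorem 6(1) cannot exist, which
excludes the hyperplane format in every compact connected Lie group of odd dimension ≥ 5 and
rank ≥ 2, and closes rank 6 in Theorem 7(ii). -/
theorem soloLie_eq_zero_of_vanishing_on_stabilizer [FiniteDimensional ℝ L]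
    (B : BilinForm ℝ L) (hB : ∀ x y z : L, B ⁅x, y⁆ z = B x ⁅y, z⁆)
    (hpos : ∀ x : L, x ≠ 0 → 0 < B x x) (μ : Module.Dual ℝ L)
    (hvan : ∀ Y : L, (∀ Z : L, μ ⁅Y, Z⁆ = 0) → μ Y = 0) : μ = 0 := by
  by_contra hμ
  obtain ⟨Y, hY, hμY⟩ := soloLie_not_nilpotent_type_of_invariant_inner_product B hB hpos μ hμ
  exact hμY (hvan Y hY)

end Summit.MatrixMultiplication.MatrixMultiplication.Theorems
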